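import Mathlib
import Summits.ValiantsHypothesis.ValiantsHypothesis.Theorems.NewtonUnitEquationsNewtonTauWeakK10Defs
import Summits.ValiantsHypothesis.ValiantsHypothesis.Theorems.NewtonUnitEquationsNewtonTauWeakCornerWords
import Summits.ValiantsHypothesis.ValiantsHypothesis.Theorems.NewtonUnitEquationsNewtonTauWeakVdpDefs

/-!
# `NewtonTauWeak` (stmt-ValiantsHypothesis-5904): primitive directions of an exponent list and the
# "no short 2-vs-1 relation" hypothesis

Support file (directions) for the siege stub `fixedKCoincidence_t2_K3` (crux `NewtonTauWeak`, KPTT arXiv:1308.2286 Conj. 1,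
rung `K = 3`, `t = 2`).  For an exponent list `d : Fin N → ℕ²`: integer exponents `toZ`, the primitive vector
`prim e = e / gcd(e₀,e₁)` of a nonzero exponent, the set of primitive directions `dirSet d` enumerated as
`dirOf d : Fin s → ℤ²`, the orientation `Edir d w e = ∓ dirOf d e` pointing to NEGATIVE `w`-weight (so that the
corner convention of `…CornerDefs.lean` applies with the weight `-w`), the direction multiplicities `Mdir`, and the
facts the local analysis consumes: positivity, genericity of `-w` on `ℤ²` from `IsGeneric w` on `ℕ²`, pairwise
non-parallel rays, and the translation of the stub's hypothesis H (no short 2-vs-1 relations among exponent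
directions within multiplicity range) into the no-escape condition of `k10_local_trichotomy`.  [routine]
-/

-- the namespace mandated for this Theorems file repeats the component `ValiantsHypothesis`
set_option linter.dupNamespace false

noncomputable section

open scoped BigOperators Polynomial
open Summit.ValiantsHypothesis.ValiantsHypothesis.Theorems.NewtonTauWeakCorner
open Summit.ValiantsHypothesis.ValiantsHypothesis.Theorems.NewtonTauWeakVdp (wdeg IsGeneric IsTop)

namespace Summit.ValiantsHypothesis.ValiantsHypothesis.Theorems.NewtonTauWeakK10

/-! ## Integer exponents and weights -/

/-- `toZ` of a finite sum. [folklore] -/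
theorem toZ_sum {ι : Type*} (s : Finset ι) (f : ι → (Fin 2 →₀ ℕ)) : toZ (∑ i ∈ s, f i) = ∑ i ∈ s, toZ (f i) := by
  classical
  induction s using Finset.induction_on with
  | empty => simp
  | insert a s ha ih => rw [Finset.sum_insert ha, Finset.sum_insert ha, toZ_add, ih]

/-- `toZ` is injective. [folklore] -/
theorem toZ_injective : Function.Injective toZ := by
  intro a b h; ext i
  have := congrFun h i
  simpa [toZ] using this

/-- `toZ e = 0 ↔ e = 0`. [folklore] -/
theorem toZ_eq_zero_iff (e : Fin 2 →₀ ℕ) : toZ e = 0 ↔ e = 0 := by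
  rw [← toZ_zero]; exact toZ_injective.eq_iff

/-- The real weighted degree is the weight of the integer exponent. [folklore] -/
theorem wdeg_eq_wt (w : Fin 2 → ℝ) (e : Fin 2 →₀ ℕ) : wdeg w e = wt w (toZ e) := by
  simp [wdeg, wt, toZ]

/-- The weight for `-w` is minus the weight for `w`. [folklore] -/
theorem wt_neg (w : Fin 2 → ℝ) (z : Fin 2 → ℤ) : wt (-w) z = -wt w z := by
  simp [wt]; ring

/-- An integer vector is a difference of two exponents. [folklore] -/
theorem exists_toZ_sub (z : Fin 2 → ℤ) : ∃ a b : Fin 2 →₀ ℕ, z = toZ a - toZ b := by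
  refine ⟨Finsupp.equivFunOnFinite.symm fun i => (z i).toNat,
    Finsupp.equivFunOnFinite.symm fun i => (-z i).toNat, ?_⟩
  funext i
  simp only [toZ, Finsupp.coe_equivFunOnFinite_symm, Pi.sub_apply]
  omega

/-- **Genericity on `ℤ²`.** A generic weight (injective weighted degree on `ℕ²`) has injective weight on `ℤ²`.
[folklore] -/
theorem wt_injective_of_isGeneric {w : Fin 2 → ℝ} (hw : IsGeneric w) : Function.Injective (wt w) := by
  intro z z' h
  obtain ⟨a, b, rfl⟩ := exists_toZ_sub z
  obtain ⟨a', b', rfl⟩ := exists_toZ_sub z'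
  have h1 : wt w (toZ a - toZ b) = wt w (toZ a) - wt w (toZ b) := by
    have := wt_add w (toZ a - toZ b) (toZ b); rw [sub_add_cancel] at this; linarith
  have h2 : wt w (toZ a' - toZ b') = wt w (toZ a') - wt w (toZ b') := by
    have := wt_add w (toZ a' - toZ b') (toZ b'); rw [sub_add_cancel] at this; linarith
  rw [h1, h2] at h
  have h3 : wdeg w (a + b') = wdeg w (a' + b) := by
    rw [wdeg_eq_wt, wdeg_eq_wt, toZ_add, toZ_add, wt_add, wt_add]; linarith
  have h4 := hw h3
  have h5 : toZ a + toZ b' = toZ a' + toZ b := by rw [← toZ_add, ← toZ_add, h4]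
  linear_combination h5

/-- The weight for `-w` is injective too. [folklore] -/
theorem wt_neg_injective_of_isGeneric {w : Fin 2 → ℝ} (hw : IsGeneric w) : Function.Injective (wt (-w)) := by
  intro z z' h
  rw [wt_neg, wt_neg, neg_inj] at h
  exact wt_injective_of_isGeneric hw h

/-- A nonzero integer vector has nonzero weight for a generic weight. [folklore] -/
theorem wt_ne_zero_of_ne_zero {w : Fin 2 → ℝ} (hw : IsGeneric w) {z : Fin 2 → ℤ} (hz : z ≠ 0) : wt w z ≠ 0 := by
  intro h
  rw [← wt_zero w] at h
  exact hz (wt_injective_of_isGeneric hw h)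

/-! ## Primitive vectors -/

/-- A nonzero exponent has positive gcd. [folklore] -/
theorem dg_pos {e : Fin 2 →₀ ℕ} (he : e ≠ 0) : 0 < dg e := by
  unfold dg
  apply Nat.pos_of_ne_zero
  intro h
  rw [Nat.gcd_eq_zero_iff] at h
  apply he
  ext i
  fin_cases i
  · exact h.1
  · exact h.2

/-- The gcd divides each coordinate. [folklore] -/
theorem dg_dvd (e : Fin 2 →₀ ℕ) (i : Fin 2) : dg e ∣ e i := by
  unfold dg
  fin_cases i
  · exact Nat.gcd_dvd_left _ _
  · exact Nat.gcd_dvd_right _ _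

/-- `e = gcd · prim e` coordinatewise. [folklore] -/
theorem apply_eq_dg_mul_prim (e : Fin 2 →₀ ℕ) (i : Fin 2) : (e i : ℤ) = (dg e : ℤ) * prim e i := by
  unfold prim
  have := Nat.div_mul_cancel (dg_dvd e i)
  push_cast
  rw [mul_comm]
  exact_mod_cast this.symm

/-- `toZ e = gcd • prim e`. [folklore] -/
theorem toZ_eq_dg_smul_prim (e : Fin 2 →₀ ℕ) : toZ e = (dg e : ℤ) • prim e := by
  funext i
  rw [Pi.smul_apply, smul_eq_mul, toZ_apply, apply_eq_dg_mul_prim]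

/-- The coordinates of the primitive vector are nonnegative. [folklore] -/
theorem prim_nonneg (e : Fin 2 →₀ ℕ) (i : Fin 2) : 0 ≤ prim e i := by
  unfold prim; exact_mod_cast Nat.zero_le _

/-- The primitive vector of a nonzero exponent is nonzero. [folklore] -/
theorem prim_ne_zero {e : Fin 2 →₀ ℕ} (he : e ≠ 0) : prim e ≠ 0 := by
  intro h
  apply he
  rw [← toZ_eq_zero_iff, toZ_eq_dg_smul_prim, h, smul_zero]

/-- The primitive vector has coprime coordinates. [folklore] -/
theorem coprime_prim {e : Fin 2 →₀ ℕ} (he : e ≠ 0) : Nat.Coprime (e 0 / dg e) (e 1 / dg e) :=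
  Nat.coprime_div_gcd_div_gcd (dg_pos he)

/-- The primitive vector is parallel to the exponent. [folklore] -/
theorem prim_cross_toZ (e : Fin 2 →₀ ℕ) : prim e 0 * toZ e 1 = prim e 1 * toZ e 0 := by
  rw [toZ_apply, toZ_apply, apply_eq_dg_mul_prim, apply_eq_dg_mul_prim]; ring

/-- **Parallel nonzero exponents have the same primitive vector.** [folklore] -/
theorem prim_eq_of_parallel {e e' : Fin 2 →₀ ℕ} (he : e ≠ 0) (he' : e' ≠ 0)
    (hpar : (e 0 : ℤ) * (e' 1 : ℤ) = (e 1 : ℤ) * (e' 0 : ℤ)) : prim e = prim e' := by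
  -- notation: coprime pairs `(a, b)`, `(a', b')`
  set a := e 0 / dg e with ha
  set b := e 1 / dg e with hb
  set a' := e' 0 / dg e' with ha'
  set b' := e' 1 / dg e' with hb'
  have hcop : Nat.Coprime a b := coprime_prim he
  have hcop' : Nat.Coprime a' b' := coprime_prim he'
  have h0 := apply_eq_dg_mul_prim e 0
  have h1 := apply_eq_dg_mul_prim e 1
  have h0' := apply_eq_dg_mul_prim e' 0
  have h1' := apply_eq_dg_mul_prim e' 1
  simp only [prim] at h0 h1 h0' h1'
  rw [← ha] at h0; rw [← hb] at h1; rw [← ha'] at h0'; rw [← hb'] at h1'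
  have hg : (0 : ℤ) < dg e := by exact_mod_cast dg_pos he
  have hg' : (0 : ℤ) < dg e' := by exact_mod_cast dg_pos he'
  -- `a b' = b a'` over `ℤ`, then over `ℕ`
  have hZ : (a : ℤ) * (b' : ℤ) = (b : ℤ) * (a' : ℤ) := by
    rw [h0, h1, h0', h1'] at hpar
    have : ((dg e : ℤ) * (dg e' : ℤ)) * ((a : ℤ) * b') = ((dg e : ℤ) * (dg e' : ℤ)) * ((b : ℤ) * a') := by
      linear_combination hpar
    exact mul_left_cancel₀ (mul_ne_zero hg.ne' hg'.ne') this
  have hN : a * b' = b * a' := by exact_mod_cast hZ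
  -- coprimality forces `a = a'` and `b = b'`
  have haa : a = a' := by
    apply Nat.dvd_antisymm
    · exact hcop.dvd_of_dvd_mul_left (Dvd.intro b' (by rw [hN, mul_comm]))
    · exact hcop'.dvd_of_dvd_mul_left (Dvd.intro b (by linear_combination hN.symm))
  have hbb : b = b' := by
    apply Nat.dvd_antisymm
    · exact hcop.symm.dvd_of_dvd_mul_left (Dvd.intro a' (by rw [← hN, mul_comm]))
    · exact hcop'.symm.dvd_of_dvd_mul_left (Dvd.intro a (by linear_combination hN))
  funext i
  fin_cases i
  · show ((a : ℕ) : ℤ) = ((a' : ℕ) : ℤ); rw [haa]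
  · show ((b : ℕ) : ℤ) = ((b' : ℕ) : ℤ); rw [hbb]

/-- Exponents with the same primitive vector are parallel. [folklore] -/
theorem parallel_of_prim_eq {e e' : Fin 2 →₀ ℕ} (h : prim e = prim e') :
    (e 0 : ℤ) * (e' 1 : ℤ) = (e 1 : ℤ) * (e' 0 : ℤ) := by
  rw [apply_eq_dg_mul_prim e 0, apply_eq_dg_mul_prim e 1, apply_eq_dg_mul_prim e' 0, apply_eq_dg_mul_prim e' 1, h]
  ring

/-- Parallel primitive vectors of nonzero exponents are equal. [folklore] -/
theorem prim_eq_of_prim_parallel {e e' : Fin 2 →₀ ℕ} (he : e ≠ 0) (he' : e' ≠ 0)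
    (hpar : prim e 0 * prim e' 1 = prim e 1 * prim e' 0) : prim e = prim e' := by
  apply prim_eq_of_parallel he he'
  rw [apply_eq_dg_mul_prim e 0, apply_eq_dg_mul_prim e 1, apply_eq_dg_mul_prim e' 0, apply_eq_dg_mul_prim e' 1]
  linear_combination ((dg e : ℤ) * (dg e' : ℤ)) * hpar

/-! ## The direction set of an exponent list and its orientation -/

variable {N : ℕ}

/-- The primitive direction of a nonzero exponent belongs to the direction set. [folklore] -/
theorem prim_mem_dirSet (d : Fin N → (Fin 2 →₀ ℕ)) {j : Fin N} (hj : d j ≠ 0) : prim (d j) ∈ dirSet d :=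
  Finset.mem_image.mpr ⟨j, Finset.mem_filter.mpr ⟨Finset.mem_univ j, hj⟩, rfl⟩

/-- Every enumerated direction is the primitive direction of some nonzero exponent. [folklore] -/
theorem exists_eq_dirOf (d : Fin N → (Fin 2 →₀ ℕ)) (e : Fin (dirSet d).card) :
    ∃ j, d j ≠ 0 ∧ prim (d j) = dirOf d e := by
  have hmem : dirOf d e ∈ dirSet d := ((dirSet d).equivFin.symm e).2
  obtain ⟨j, hj, hjy⟩ := Finset.mem_image.mp hmem
  exact ⟨j, (Finset.mem_filter.mp hj).2, hjy⟩

/-- Every nonzero exponent has an enumerated direction. [folklore] -/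
theorem exists_dirOf_eq (d : Fin N → (Fin 2 →₀ ℕ)) {j : Fin N} (hj : d j ≠ 0) : ∃ e, dirOf d e = prim (d j) :=
  ⟨(dirSet d).equivFin ⟨prim (d j), prim_mem_dirSet d hj⟩, by simp [dirOf]⟩

/-- The enumeration of directions is injective. [folklore] -/
theorem dirOf_injective (d : Fin N → (Fin 2 →₀ ℕ)) : Function.Injective (dirOf d) := by
  intro e e' h
  have : (dirSet d).equivFin.symm e = (dirSet d).equivFin.symm e' := Subtype.ext h
  exact (dirSet d).equivFin.symm.injective this

/-- An enumerated direction is nonzero with nonnegative coordinates. [folklore] -/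
theorem dirOf_ne_zero (d : Fin N → (Fin 2 →₀ ℕ)) (e : Fin (dirSet d).card) :
    dirOf d e ≠ 0 ∧ ∀ i, 0 ≤ dirOf d e i := by
  obtain ⟨j, hj, hjy⟩ := exists_eq_dirOf d e
  rw [← hjy]
  exact ⟨prim_ne_zero hj, prim_nonneg (d j)⟩

/-- The orientation sign is `±1`. [folklore] -/
theorem sgnW_sq (w : Fin 2 → ℝ) (y : Fin 2 → ℤ) : sgnW w y = 1 ∨ sgnW w y = -1 := by
  unfold sgnW; split_ifs <;> simp

/-- **Positivity.** The oriented directions have positive weight for `-w` (generic `w`). [folklore] -/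
theorem wt_neg_Edir_pos (d : Fin N → (Fin 2 →₀ ℕ)) {w : Fin 2 → ℝ} (hw : IsGeneric w) (e : Fin (dirSet d).card) :
    0 < wt (-w) (Edir d w e) := by
  have hne := wt_ne_zero_of_ne_zero hw (dirOf_ne_zero d e).1
  rw [wt_neg, Edir, wt_zsmul, sgnW]
  split_ifs with h
  · push_cast; linarith
  · push Not at h
    have : wt w (dirOf d e) < 0 := lt_of_le_of_ne h hne
    push_cast; linarith

/-- **Pairwise non-parallel rays.** `k·E_e = k'·E_{e'}` with `k ≥ 1` forces `e = e'`. [folklore] -/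
theorem Edir_nonparallel (d : Fin N → (Fin 2 →₀ ℕ)) (w : Fin 2 → ℝ) :
    ∀ e e' : Fin (dirSet d).card, ∀ k k' : ℕ, 1 ≤ k → (k : ℤ) • Edir d w e = (k' : ℤ) • Edir d w e' → e = e' := by
  intro e e' k k' hk h
  obtain ⟨j, hj, hjy⟩ := exists_eq_dirOf d e
  obtain ⟨j', hj', hjy'⟩ := exists_eq_dirOf d e'
  apply dirOf_injective d
  rw [← hjy, ← hjy']
  apply prim_eq_of_prim_parallel hj hj'
  -- from the vector identity, the two primitive vectors are parallel
  have h0 := congrFun h 0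
  have h1 := congrFun h 1
  simp only [Edir, Pi.smul_apply, smul_eq_mul, ← hjy, ← hjy'] at h0 h1
  have hk0 : ((k : ℤ) * sgnW w (prim (d j))) ≠ 0 := by
    apply mul_ne_zero (by exact_mod_cast (by omega : k ≠ 0))
    rcases sgnW_sq w (prim (d j)) with h | h <;> rw [h] <;> norm_num
  -- `(k σ) p = (k' σ') p'` coordinatewise gives `p × p' = 0`
  have key : ((k : ℤ) * sgnW w (prim (d j))) * (prim (d j) 0 * prim (d j') 1 - prim (d j) 1 * prim (d j') 0) = 0 := by
    linear_combination (prim (d j') 1) * h0 - (prim (d j') 0) * h1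
  rcases mul_eq_zero.mp key with h | h
  · exact absurd h hk0
  · linarith

/-! ## Direction multiplicities and the no-escape condition -/

/-- The multiplicity bound: `M_e · (dirOf e)_i ≤ Σ_{j ∥ j₁} (d j)_i` for any `j₁` on the line `e`. [folklore] -/
theorem Mdir_mul_le (d : Fin N → (Fin 2 →₀ ℕ)) (e : Fin (dirSet d).card) {j₁ : Fin N}
    (hj₁e : prim (d j₁) = dirOf d e) (i : Fin 2) :
    (Mdir d e : ℤ) * dirOf d e i ≤
      ∑ j, if (d j 0 : ℤ) * (d j₁ 1 : ℤ) = (d j 1 : ℤ) * (d j₁ 0 : ℤ) then (d j i : ℤ) else 0 := by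
  classical
  unfold Mdir
  push_cast
  rw [Finset.sum_mul, Finset.sum_filter]
  refine Finset.sum_le_sum fun j _ => ?_
  by_cases hcls : d j ≠ 0 ∧ prim (d j) = dirOf d e
  · rw [if_pos hcls]
    have hpar : (d j 0 : ℤ) * (d j₁ 1 : ℤ) = (d j 1 : ℤ) * (d j₁ 0 : ℤ) :=
      parallel_of_prim_eq (hcls.2.trans hj₁e.symm)
    rw [if_pos hpar, apply_eq_dg_mul_prim (d j) i, hcls.2]
  · rw [if_neg hcls]
    split_ifs
    · exact_mod_cast Nat.zero_le _
    · exact le_rfl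

/-- **No escape.** Under the stub's hypothesis H (no short 2-vs-1 relation among the exponent directions within
multiplicity range), no point `k₁E_{e₁} + k₂E_{e₂}` with `e₁ ≠ e₂`, `1 ≤ k_i ≤ M_{e_i}` lies on a ray of the oriented
local directions. [this line; routine translation] -/
theorem k10_noEsc_of_H {N : ℕ} (d : Fin N → (Fin 2 →₀ ℕ)) {w : Fin 2 → ℝ}
    (H : ∀ (j₁ j₂ j₃ : Fin N) (z₁ z₂ : Fin 2 → ℤ), d j₁ ≠ 0 → d j₂ ≠ 0 → d j₃ ≠ 0 →
      (d j₁ 0 : ℤ) * (d j₂ 1 : ℤ) ≠ (d j₁ 1 : ℤ) * (d j₂ 0 : ℤ) → z₁ ≠ 0 →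
      z₁ 0 * (d j₁ 1 : ℤ) = z₁ 1 * (d j₁ 0 : ℤ) →
      (∀ i, |z₁ i| ≤ ∑ j, if (d j 0 : ℤ) * (d j₁ 1 : ℤ) = (d j 1 : ℤ) * (d j₁ 0 : ℤ) then (d j i : ℤ) else 0) →
      z₂ ≠ 0 → z₂ 0 * (d j₂ 1 : ℤ) = z₂ 1 * (d j₂ 0 : ℤ) →
      (∀ i, |z₂ i| ≤ ∑ j, if (d j 0 : ℤ) * (d j₂ 1 : ℤ) = (d j 1 : ℤ) * (d j₂ 0 : ℤ) then (d j i : ℤ) else 0) →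
      (z₁ 0 + z₂ 0) * (d j₃ 1 : ℤ) ≠ (z₁ 1 + z₂ 1) * (d j₃ 0 : ℤ)) :
    ∀ e₁ e₂ : Fin (dirSet d).card, e₁ ≠ e₂ → ∀ k₁ k₂ : ℕ, 1 ≤ k₁ → k₁ ≤ Mdir d e₁ → 1 ≤ k₂ → k₂ ≤ Mdir d e₂ →
      ¬ OnRay (Edir d w) ((k₁ : ℤ) • Edir d w e₁ + (k₂ : ℤ) • Edir d w e₂) := by
  intro e₁ e₂ hne k₁ k₂ hk₁ hk₁M hk₂ hk₂M hray
  obtain ⟨e₃, k₃, _, hk₃⟩ := hray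
  obtain ⟨j₁, hj₁, hjy₁⟩ := exists_eq_dirOf d e₁
  obtain ⟨j₂, hj₂, hjy₂⟩ := exists_eq_dirOf d e₂
  obtain ⟨j₃, hj₃, hjy₃⟩ := exists_eq_dirOf d e₃
  -- the two bounded vectors on the lines of `d j₁`, `d j₂`
  set z₁ : Fin 2 → ℤ := (k₁ : ℤ) • Edir d w e₁ with hz₁
  set z₂ : Fin 2 → ℤ := (k₂ : ℤ) • Edir d w e₂ with hz₂
  have hnotpar : (d j₁ 0 : ℤ) * (d j₂ 1 : ℤ) ≠ (d j₁ 1 : ℤ) * (d j₂ 0 : ℤ) := by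
    intro hpar
    have := prim_eq_of_parallel hj₁ hj₂ hpar
    rw [hjy₁, hjy₂] at this
    exact hne (dirOf_injective d this)
  -- generic facts about `z = k • E_e` for `j` on the line `e`
  have hfacts : ∀ (e : Fin (dirSet d).card) (k : ℕ) (j : Fin N), 1 ≤ k → k ≤ Mdir d e → d j ≠ 0 →
      prim (d j) = dirOf d e →
      ((k : ℤ) • Edir d w e) ≠ 0 ∧
      ((k : ℤ) • Edir d w e) 0 * (d j 1 : ℤ) = ((k : ℤ) • Edir d w e) 1 * (d j 0 : ℤ) ∧
      ∀ i, |((k : ℤ) • Edir d w e) i| ≤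
        ∑ j', if (d j' 0 : ℤ) * (d j 1 : ℤ) = (d j' 1 : ℤ) * (d j 0 : ℤ) then (d j' i : ℤ) else 0 := by
    intro e k j hk hkM hj hje
    have hsg := sgnW_sq w (dirOf d e)
    refine ⟨?_, ?_, fun i => ?_⟩
    · intro h0
      have : (k : ℤ) * sgnW w (dirOf d e) ≠ 0 := by
        apply mul_ne_zero (by exact_mod_cast (by omega : k ≠ 0))
        rcases hsg with h | h <;> rw [h] <;> norm_num
      apply (dirOf_ne_zero d e).1
      have h' : ((k : ℤ) * sgnW w (dirOf d e)) • dirOf d e = 0 := by rw [mul_smul]; exact h0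
      exact (smul_eq_zero.mp h').resolve_left this
    · simp only [Edir, Pi.smul_apply, smul_eq_mul, ← hje]
      have := prim_cross_toZ (d j)
      simp only [toZ_apply] at this
      linear_combination ((k : ℤ) * sgnW w (prim (d j))) * this
    · have hb := Mdir_mul_le d e hje i
      simp only [Edir, Pi.smul_apply, smul_eq_mul]
      have habs : |(k : ℤ) * (sgnW w (dirOf d e) * dirOf d e i)| = (k : ℤ) * dirOf d e i := by
        rcases hsg with h | h
        · rw [h, one_mul, abs_of_nonneg]
          exact mul_nonneg (by positivity) ((dirOf_ne_zero d e).2 i)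
        · rw [h, neg_one_mul, mul_neg, abs_neg, abs_of_nonneg]
          exact mul_nonneg (by positivity) ((dirOf_ne_zero d e).2 i)
      rw [habs]
      have hkle : (k : ℤ) * dirOf d e i ≤ (Mdir d e : ℤ) * dirOf d e i :=
        mul_le_mul_of_nonneg_right (by exact_mod_cast hkM) ((dirOf_ne_zero d e).2 i)
      exact hkle.trans hb
  obtain ⟨hz₁0, hz₁par, hz₁bd⟩ := hfacts e₁ k₁ j₁ hk₁ hk₁M hj₁ hjy₁
  obtain ⟨hz₂0, hz₂par, hz₂bd⟩ := hfacts e₂ k₂ j₂ hk₂ hk₂M hj₂ hjy₂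
  refine H j₁ j₂ j₃ z₁ z₂ hj₁ hj₂ hj₃ hnotpar hz₁0 hz₁par hz₁bd hz₂0 hz₂par hz₂bd ?_
  -- the sum is `k₃ • E_{e₃}`, parallel to `d j₃`
  have hsum0 : z₁ 0 + z₂ 0 = ((k₃ : ℤ) • Edir d w e₃) 0 := by rw [← hk₃]; rfl
  have hsum1 : z₁ 1 + z₂ 1 = ((k₃ : ℤ) • Edir d w e₃) 1 := by rw [← hk₃]; rfl
  rw [hsum0, hsum1]
  simp only [Edir, Pi.smul_apply, smul_eq_mul, ← hjy₃]
  have := prim_cross_toZ (d j₃)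
  simp only [toZ_apply] at this
  linear_combination ((k₃ : ℤ) * sgnW w (prim (d j₃))) * this

end Summit.ValiantsHypothesis.ValiantsHypothesis.Theorems.NewtonTauWeakK10

end
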